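import Summits.BirchSwinnertonDyer.BirchSwinnertonDyer.Theorems.GenusKolyvaginAtTwoMultiGenusPrimitivityAtTwoLevelOne

/-!
# Route `GenusKolyvaginAtTwo`, crux stmt-BirchSwinnertonDyer-24947 `MultiGenusPrimitivityAtTwo` (U): the crux BY NAME from its one
# open registered stub `stub_positiveDepth` (the other stub, `stub_levelOne`, is the landed theorem p605391)

Lead prover seat bsd-line-gk2-p1 (g4). The pen's birth skeleton `U_birth.lean` (registered 2026-08-28T03:32Z) splits U on the
`2`-divisibility of `P(1) = y_K` in `E(K[1])`: `stub_levelOne` (`M₀ = 0`, PROVED: `MultiGenusPrimitivityAtTwo.stub_levelOne`) and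
`stub_positiveDepth` (`M₀ ≥ 1`, OPEN — the whole open content of U). This file records the composition in the tree:
`multiGenusPrimitivityAtTwo_of_stubPositiveDepth : «stub_positiveDepth, registered signature verbatim» → MultiGenusPrimitivityAtTwo`
(case split on `∃ Q, 2Q = P(1)`), so that 24947 is CLOSED MODULO ITS ONE OPEN STUB by name. CONDITIONAL on that stub; nothing else.
Standing caveat (REPAIR CENSUS v1.2 §6, evidence STATE-24947-g4.md): in bare ∀K-form `stub_positiveDepth` is BSD-side unsatisfiable at
Heegner fields with `DEF(W,K) ≥ 3`; the consistent re-typing carries `DEF(W,K) = 1` (typed texts: evidence `U_DEF1_typed.lean`), and the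
same one-line composition holds for the restricted pair. Helper (`--supports stmt-BirchSwinnertonDyer-24947`); BSD is not proved by any of this.
-/

set_option linter.dupNamespace false -- tree convention: `Summit.BirchSwinnertonDyer.BirchSwinnertonDyer.Theorems` (D-0017)

namespace Summit.BirchSwinnertonDyer.BirchSwinnertonDyer.Theorems.MultiGenusPrimitivityAtTwo

open Summit.BirchSwinnertonDyer.BirchSwinnertonDyer.Theses.GenusKolyvaginAtTwo Literature.NumberTheory.EllipticCurves

/-- **Crux 24947 `MultiGenusPrimitivityAtTwo` BY NAME from its open stub `stub_positiveDepth`** (registered signature verbatim as the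
hypothesis; the `M₀ = 0` case is the landed `stub_levelOne`). [cite: GrossLMS1991, §4 (P_1 = Tr y_1 = y_K)] -/
theorem multiGenusPrimitivityAtTwo_of_stubPositiveDepth
    (hpos : ∀ (W : WeierstrassCurve ℚ) [W.IsElliptic] [W.IsGloballyMinimal] [NeZero (W.conductorNorm ℤ)], ¬ W.HasCM → W.analyticRank = 0 → (∀ n : ℕ, 0 < n → W.HasSurjectiveModNGaloisRep ((2 : ℤ) ^ n)) → Odd W.tamagawaProduct → ∀ (K : Type) [Field K] [NumberField K], Literature.NumberTheory.EllipticCurves.IsImaginaryQuadratic K → Odd (NumberField.discr K) → NumberField.discr K ≠ -3 → Literature.NumberTheory.EllipticCurves.SatisfiesHeegnerHypothesis (W.conductorNorm ℤ) K → ¬ IsSquare ((NumberField.discr K : ℚ) * -|W.Δ|) → ¬ IsSquare ((NumberField.discr K : ℚ) * (-(2 * |W.Δ|))) → ∀ (Dt : Literature.NumberTheory.EllipticCurves.ModularForms.ModularParametrizationData W (W.conductorNorm ℤ)), (∀ z ∈ Dt.L.lattice, ∃ w ∈ Literature.NumberTheory.EllipticCurves.ModularForms.periodLattice Dt.f, z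 = (Dt.c : ℂ) * w) → Odd Dt.c → ∀ (β : ℤ) (ι : K →+* ℂ) (d₁ : Literature.NumberTheory.EllipticCurves.KolyvaginHeegnerData Dt β ι 1), ¬ IsOfFinAddOrder d₁.derivedPoint → ∀ (Wd : WeierstrassCurve ℚ) [Wd.IsElliptic] [Wd.IsGloballyMinimal], (∃ C : WeierstrassCurve.VariableChange ℚ, C • W.quadraticTwist (NumberField.discr K : ℚ) = Wd) → Wd.analyticRank = 1 → Nat.card (Wd.selmerGroup 2) = 2 → (∃ Q : (W.baseChange (Literature.NumberTheory.EllipticCurves.ringClassField K ι 1)).toAffine.Point, (2 : ℤ) • Q = d₁.derivedPoint) → ∃ (n : ℕ) (d : Literature.NumberTheory.EllipticCurves.KolyvaginHeegnerData Dt β ι n) (θ : ℕ → Literature.NumberTheory.EllipticCurves.ringClassField K ι n) (T : Finset (Literature.NumberTheory.EllipticCurves.ringClassField K ι n ≃ₐ[ℚ] Literature.NumberTheory.EllipticCurves.ringClassField K ι n)), Squarefree n ∧ (∀ ℓ ∈ n.primeFactors, Literature.NumberTheory.EllipticCurves.Zhang2014.IsKolyvaginPrime (W.conductorNorm ℤ)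 W K 2 ℓ) ∧ (∀ ℓ ∈ n.primeFactors, θ ℓ ^ 2 = algebraMap ℚ (Literature.NumberTheory.EllipticCurves.ringClassField K ι n) ((-1 : ℚ) ^ (ℓ / 2) * ℓ)) ∧ (∀ g, g ∈ T ↔ g ∈ Literature.NumberTheory.EllipticCurves.ringClassGal ι n ∧ ∀ ℓ ∈ n.primeFactors, g (θ ℓ) = θ ℓ) ∧ ¬ ∃ Q : (W.baseChange (Literature.NumberTheory.EllipticCurves.ringClassField K ι n)).toAffine.Point, (2 : ℤ) • Q = ∑ g ∈ T, Literature.NumberTheory.EllipticCurves.pointGalHom W (Literature.NumberTheory.EllipticCurves.ringClassField K ι n) g d.y) :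
    MultiGenusPrimitivityAtTwo := by
  intro W _ _ _ hcm hr0 hρ hT K _ _ hIQ hodd h3 hHe hsq1 hsq2 Dt hopt hc β ι d₁ hy Wd _ _ hWd hrd hSel
  by_cases hM₀ : ∃ Q : (W.baseChange (ringClassField K ι 1)).toAffine.Point, (2 : ℤ) • Q = d₁.derivedPoint
  · exact hpos W hcm hr0 hρ hT K hIQ hodd h3 hHe hsq1 hsq2 Dt hopt hc β ι d₁ hy Wd hWd hrd hSel hM₀
  · exact stub_levelOne W hcm hr0 hρ hT K hIQ hodd h3 hHe hsq1 hsq2 Dt hopt hc β ι d₁ hy Wd hWd hrd hSel hM₀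

/-- **Conversely, U gives `stub_positiveDepth`** (drop the extra hypothesis): the open stub IS the crux, given `stub_levelOne`. [folklore] -/
theorem stubPositiveDepth_of_multiGenusPrimitivityAtTwo (hU : MultiGenusPrimitivityAtTwo) :
    ∀ (W : WeierstrassCurve ℚ) [W.IsElliptic] [W.IsGloballyMinimal] [NeZero (W.conductorNorm ℤ)], ¬ W.HasCM → W.analyticRank = 0 → (∀ n : ℕ, 0 < n → W.HasSurjectiveModNGaloisRep ((2 : ℤ) ^ n)) → Odd W.tamagawaProduct → ∀ (K : Type) [Field K] [NumberField K], Literature.NumberTheory.EllipticCurves.IsImaginaryQuadratic K → Odd (NumberField.discr K) → NumberField.discr K ≠ -3 → Literature.NumberTheory.EllipticCurves.SatisfiesHeegnerHypothesis (W.conductorNorm ℤ) K → ¬ IsSquare ((NumberField.discr K : ℚ) * -|W.Δ|) → ¬ IsSquare ((NumberField.discr K : ℚ) * (-(2 * |W.Δ|))) → ∀ (Dt : Literature.NumberTheory.EllipticCurves.ModularForms.ModularParametrizationData W (W.conductorNorm ℤ)), (∀ z ∈ Dt.L.lattice, ∃ w ∈ Literature.NumberTheory.EllipticCurves.ModularForms.periodLattice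 Dt.f, z = (Dt.c : ℂ) * w) → Odd Dt.c → ∀ (β : ℤ) (ι : K →+* ℂ) (d₁ : Literature.NumberTheory.EllipticCurves.KolyvaginHeegnerData Dt β ι 1), ¬ IsOfFinAddOrder d₁.derivedPoint → ∀ (Wd : WeierstrassCurve ℚ) [Wd.IsElliptic] [Wd.IsGloballyMinimal], (∃ C : WeierstrassCurve.VariableChange ℚ, C • W.quadraticTwist (NumberField.discr K : ℚ) = Wd) → Wd.analyticRank = 1 → Nat.card (Wd.selmerGroup 2) = 2 → (∃ Q : (W.baseChange (Literature.NumberTheory.EllipticCurves.ringClassField K ι 1)).toAffine.Point, (2 : ℤ) • Q = d₁.derivedPoint) → ∃ (n : ℕ) (d : Literature.NumberTheory.EllipticCurves.KolyvaginHeegnerData Dt β ι n) (θ : ℕ → Literature.NumberTheory.EllipticCurves.ringClassField K ι n) (T : Finset (Literature.NumberTheory.EllipticCurves.ringClassField K ι n ≃ₐ[ℚ] Literature.NumberTheory.EllipticCurves.ringClassField K ι n)), Squarefree n ∧ (∀ ℓ ∈ n.primeFactors, Literature.NumberTheory.EllipticCurves.Zhang2014.IsKolyvaginPrime (W.conductorNorm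 ℤ) W K 2 ℓ) ∧ (∀ ℓ ∈ n.primeFactors, θ ℓ ^ 2 = algebraMap ℚ (Literature.NumberTheory.EllipticCurves.ringClassField K ι n) ((-1 : ℚ) ^ (ℓ / 2) * ℓ)) ∧ (∀ g, g ∈ T ↔ g ∈ Literature.NumberTheory.EllipticCurves.ringClassGal ι n ∧ ∀ ℓ ∈ n.primeFactors, g (θ ℓ) = θ ℓ) ∧ ¬ ∃ Q : (W.baseChange (Literature.NumberTheory.EllipticCurves.ringClassField K ι n)).toAffine.Point, (2 : ℤ) • Q = ∑ g ∈ T, Literature.NumberTheory.EllipticCurves.pointGalHom W (Literature.NumberTheory.EllipticCurves.ringClassField K ι n) g d.y := by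
  intro W _ _ _ hcm hr0 hρ hT K _ _ hIQ hodd h3 hHe hsq1 hsq2 Dt hopt hc β ι d₁ hy Wd _ _ hWd hrd hSel _
  exact hU W hcm hr0 hρ hT K hIQ hodd h3 hHe hsq1 hsq2 Dt hopt hc β ι d₁ hy Wd hWd hrd hSel

end Summit.BirchSwinnertonDyer.BirchSwinnertonDyer.Theorems.MultiGenusPrimitivityAtTwo
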